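import Literature.MathematicalPhysics.QuantumFieldTheory.Balaban1983to89.BlockAveragingExpMeanLog
import HarnessLib

/-!
# A CONTINUOUS inhabitant of `LoopAverage SU(N)` agreeing with the printed `exp[i Σ |I|⁻¹ (1/i) log W_i]` near the identity

[Balaban1987RG1] (CMP 109) (0.4) p. 253 defines the block averaging through the small-loop operation
`{W_i} ↦ exp[i Σ_i |I|⁻¹ (1/i) log W_i]`, which is meaningful only «for a set {U_j} of elements close to the identity of
the group» (the logarithm), and asks of it the axioms (0.5)–(0.9) there; p. 253: «The considerations and results of this,
and previous papers, do not depend on any particular averaging operation used; they are valid universally for all averages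
satisfying the above properties.»  The tree's inhabitant `ExpMeanLog.expMeanLogSU` (module `BlockAveragingExpMeanLog`)
extends the printed operation to ALL families by the value `1` off the guard `{∀ i, ‖W_i − 1‖ < δ_N}`,
`δ_N = min(1/3, π/N)` — a measurable but DISCONTINUOUS total extension (`measurable_ESU` is proved by
`ContinuousOn.measurable_piecewise`).  Consequently the total block averaging `BlockAveraging.blockAvg expMeanLogSU` is not
continuous in the configuration, and unit-scale averaged loop variables are Borel but not continuous functions of a finer
field — which blocks the direct use of uniform (Stone–Weierstrass / Lévy) density arguments for them (cell ym3-torus,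
TARGET N9, R-flag «D2-CONT»; tree `WilsonLoopDensityFiniteGraph`).

THIS FILE gives a second total extension, `ExpMeanLog.expMeanLogSUc`, that is CONTINUOUS and equally faithful to print:
with a continuous cutoff `χ(W) = ∏_i φ(‖W_i − 1‖) ∈ [0, 1]`, `φ = 1` on `[0, δ_N/2]`, `φ = 0` on `[3δ_N/4, ∞)`, piecewise
linear in between, set
`E_c(W) = exp[ χ(W) · |I|⁻¹ Σ_i log W_i ]`.
* On the half-guard `{∀ i, ‖W_i − 1‖ ≤ δ_N/2}` this IS the printed operation (`coe_ESUc_of_small`);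
* it is `SU(N)`-valued everywhere (`χ ≠ 0` forces all `‖W_i − 1‖ < δ_N`, where each `log W_i` is skew-Hermitian and
  traceless, §3 of the sibling module; `exp_smul_mem_specialUnitaryGroup`);
* it satisfies (0.5) (inversion), (0.6) (conjugation equivariance), (0.7) (permutation invariance) on the WHOLE guard
  `{∀ i, ‖W_i − 1‖ < δ_N}` — the scaled exponent inherits them from `log` (`ESUc_inv`, `ESUc_conj`, `ESUc_perm`) — so
  `expMeanLogSUc : LoopAverage SU(N)` with the same radius `δ_N` as `expMeanLogSU`;
* it equals `1` as soon as some `‖W_i − 1‖ ≥ 3δ_N/4` (`ESUc_eq_one_of_le`), in particular off the guard, and it is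
  CONTINUOUS as a map `(I → SU(N)) → SU(N)` for every finite `I` (`continuous_ESUc`): near a family with all
  `‖W_i − 1‖ < 1` both `χ` and the mean logarithm are continuous; near any other family `χ ≡ 0` locally.
* CONSEQUENCE (`BlockAveraging` level, any lattice `P`, level `j`): the correction factor of (0.4) has no jump —
  `corr expMeanLogSUc U c = expMeanLogSUc.avg (loopHol U c)` for EVERY `U` (`corr_expMeanLogSUc_eq`) — hence the total block
  averaging `avgFun expMeanLogSUc : GaugeField P j SU(N) → GaugeField P (j+1) SU(N)` is CONTINUOUS
  (`continuous_avgFun_expMeanLogSUc`), and so are holonomies and loop variables `Re tr` of block-averaged fields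
  (`continuous_holAt`, `continuous_loopAt_avgFun_expMeanLogSUc`).

Why this is faithful to print: (0.4)–(0.7) constrain the operation only on small families (tree `LoopAverage`: «off it the
values of E are unconstrained»); (0.8) (linearisation) concerns the germ at the identity, where `E_c = ` the printed
operation; B12 p. 253 declares all results valid for every average with these properties.  What is NOT claimed: analyticity
(0.9)/`Gᶜ`-valuedness of the EXTENSION (the printed operation is analytic on the half-guard, sibling §7; the cutoff is only
continuous), and nothing about `U(N)` (the same construction works with `δ = 1/3`; not needed by the d = 3 programme).

Sources: [Balaban1987RG1] (0.4)–(0.7) and the universality sentence p. 253; the sibling module's §§1–5 for every algebraic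
identity of `log`/`exp` used.  Cell record: run/shared/lean/pub/ym3-torus/LIT-INDEX.md §4 L-3 (v2.2, R-flag D2-CONT).
-/

noncomputable section

open NormedSpace Topology Filter

namespace Literature.MathematicalPhysics.QuantumFieldTheory.Balaban1983to89

namespace ExpMeanLog

open MatrixLog B7BlockAvgLog
open Literature.MathematicalPhysics.QuantumLattice (logOnePlus_conj exp_conj_eq_of_mul_eq_one fundamentalRep
  continuous_fundamentalRep)
open Literature.Analysis.Complex (logOnePlus continuousOn_logOnePlus_comp)
open Literature.Analysis.Matrix (det_exp_eq_exp_trace)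

/-! ## 1. The cutoff profile -/

section Cutoff

/-- The piecewise-linear cutoff profile `φ_δ(t) = max(0, min(1, (3δ − 4t)/δ))`: equal to `1` for `t ≤ δ/2`, to `0` for
`t ≥ 3δ/4`, and in `[0, 1]` always. [folklore] -/
def cutProfile (δ t : ℝ) : ℝ := max 0 (min 1 ((3 * δ - 4 * t) / δ))

/-- `φ_δ` is continuous in `t`. [folklore] -/
private theorem continuous_cutProfile (δ : ℝ) : Continuous (cutProfile δ) := by
  unfold cutProfile
  fun_prop

/-- `φ_δ(t) = 1` for `t ≤ δ/2` (`δ > 0`). [folklore] -/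
private theorem cutProfile_eq_one {δ t : ℝ} (hδ : 0 < δ) (ht : t ≤ δ / 2) : cutProfile δ t = 1 := by
  unfold cutProfile
  have h : 1 ≤ (3 * δ - 4 * t) / δ := by
    rw [le_div_iff₀ hδ]; linarith
  rw [min_eq_left h, max_eq_right zero_le_one]

/-- `φ_δ(t) = 0` for `t ≥ 3δ/4` (`δ > 0`). [folklore] -/
private theorem cutProfile_eq_zero {δ t : ℝ} (hδ : 0 < δ) (ht : 3 * δ / 4 ≤ t) : cutProfile δ t = 0 := by
  unfold cutProfile
  have h : (3 * δ - 4 * t) / δ ≤ 0 := div_nonpos_of_nonpos_of_nonneg (by linarith) hδ.le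
  rw [max_eq_left]
  exact (min_le_right _ _).trans h

end Cutoff

/-! ## 2. The scaled printed operation `exp[r · |I|⁻¹ Σ log W_i]` on matrices -/

section Matrices

open scoped Matrix.Norms.L2Operator

variable {n : Type*} [Fintype n] [DecidableEq n] {ι : Type*} [Fintype ι]

/-- The MEAN LOGARITHM `|I|⁻¹ Σ_i log W_i` of a finite family of matrices (series logarithm (21) of B7; the exponent of the
printed operation: `eml W = exp (meanLog W)`, sibling `eml_eq_exp`). [cite: Balaban1987RG1, (0.4) p.253] -/
def meanLog (W : ι → Matrix n n ℂ) : Matrix n n ℂ := ((Fintype.card ι : ℂ))⁻¹ • ∑ i, mlog (W i)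

/-- `eml W = exp (meanLog W)`. [cite: Balaban1987RG1, (0.4) p.253] -/
theorem eml_eq_exp_meanLog (W : ι → Matrix n n ℂ) : eml W = exp (meanLog W) := eml_eq_exp W

/-- The SCALED operation `exp[r · |I|⁻¹ Σ_i log W_i]`, `r ∈ ℝ` (`r = 1`: the printed operation; `r = 0`: the value `1`).
[cite: Balaban1987RG1, (0.4) p.253] -/
def emlc (r : ℝ) (W : ι → Matrix n n ℂ) : Matrix n n ℂ := exp ((r : ℂ) • meanLog W)

/-- `emlc 1 = eml`. [cite: Balaban1987RG1, (0.4) p.253] -/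
theorem emlc_one (W : ι → Matrix n n ℂ) : emlc 1 W = eml W := by
  rw [emlc, Complex.ofReal_one, one_smul, eml_eq_exp_meanLog]

/-- `emlc 0 W = 1`. [cite: Balaban1987RG1, (0.4) p.253] -/
theorem emlc_zero (W : ι → Matrix n n ℂ) : emlc 0 W = 1 := by
  rw [emlc, Complex.ofReal_zero, zero_smul, exp_zero]

/-- The mean logarithm is conjugation-EQUIVARIANT (no smallness): `meanLog (v W_i w) = v (meanLog W) w` for `vw = wv = 1`.
[cite: Balaban1987RG1, (0.6) p.253] -/
theorem meanLog_conj {v w : Matrix n n ℂ} (hvw : v * w = 1) (hwv : w * v = 1) (W : ι → Matrix n n ℂ) :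
    meanLog (fun i => v * W i * w) = v * meanLog W * w := by
  unfold meanLog
  simp_rw [mlog_conj hvw hwv]
  rw [← Finset.sum_mul, ← Finset.mul_sum, ← smul_mul_assoc, ← mul_smul_comm]

/-- The mean logarithm is permutation invariant. [cite: Balaban1987RG1, (0.7) p.253] -/
theorem meanLog_comp_equiv (W : ι → Matrix n n ℂ) (σ : Equiv.Perm ι) : meanLog (W ∘ σ) = meanLog W := by
  unfold meanLog
  simp only [Function.comp_apply]
  rw [Equiv.sum_comp σ (fun i => mlog (W i))]

/-- The mean logarithm of the pointwise inverses is MINUS the mean logarithm, on `‖W_i − 1‖ ≤ 1/3` (sibling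
`meanLog_eq_neg_of_mul_eq_one`). [cite: Balaban1987RG1, (0.5) p.253] -/
theorem meanLog_eq_neg {X Y : ι → Matrix n n ℂ} (h : ∀ i, X i * Y i = 1) (hX : ∀ i, ‖X i - 1‖ ≤ 1 / 3) :
    meanLog Y = -meanLog X :=
  meanLog_eq_neg_of_mul_eq_one h hX

/-- **(0.6) for the scaled operation** (all families): `emlc r (v W_i w) = v (emlc r W) w` for `vw = wv = 1`.
[cite: Balaban1987RG1, (0.6) p.253] -/
theorem emlc_conj (r : ℝ) {v w : Matrix n n ℂ} (hvw : v * w = 1) (hwv : w * v = 1) (W : ι → Matrix n n ℂ) :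
    emlc r (fun i => v * W i * w) = v * emlc r W * w := by
  rw [emlc, emlc, meanLog_conj hvw hwv, ← smul_mul_assoc, ← mul_smul_comm, exp_conj_eq_of_mul_eq_one hvw hwv]

/-- **(0.7) for the scaled operation** (all families). [cite: Balaban1987RG1, (0.7) p.253] -/
theorem emlc_comp_equiv (r : ℝ) (W : ι → Matrix n n ℂ) (σ : Equiv.Perm ι) : emlc r (W ∘ σ) = emlc r W := by
  rw [emlc, emlc, meanLog_comp_equiv]

/-- **(0.5) for the scaled operation**: if `X_i Y_i = 1` and `‖X_i − 1‖ ≤ 1/3` for all `i`, then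
`emlc r Y · emlc r X = 1` (same scale `r` on both). [cite: Balaban1987RG1, (0.5) p.253] -/
theorem emlc_inv_mul (r : ℝ) {X Y : ι → Matrix n n ℂ} (h : ∀ i, X i * Y i = 1) (hX : ∀ i, ‖X i - 1‖ ≤ 1 / 3) :
    emlc r Y * emlc r X = 1 := by
  letI : NormedAlgebra ℚ (Matrix n n ℂ) := NormedAlgebra.restrictScalars ℚ ℂ _
  rw [emlc, emlc, meanLog_eq_neg h hX, smul_neg, ← exp_add_of_commute (Commute.refl _).neg_left, neg_add_cancel,
    exp_zero]

/-- On a family of unitaries with `‖W_i − 1‖ ≤ 1/3` the mean logarithm is SKEW-HERMITIAN. [cite: Balaban1987RG1, (0.9) p.253] -/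
theorem star_meanLog {W : ι → Matrix n n ℂ} (hW : ∀ i, W i ∈ Matrix.unitaryGroup n ℂ) (hs : ∀ i, ‖W i - 1‖ ≤ 1 / 3) :
    star (meanLog W) = -meanLog W := by
  unfold meanLog
  simp only [star_smul, star_sum, star_inv₀, star_natCast, star_mlog_eq_neg (hW _) (hs _), Finset.sum_neg_distrib,
    smul_neg]

/-- On a family in `SU(N)` with `‖W_i − 1‖ ≤ 1/3`, `N‖W_i − 1‖ < π`, the mean logarithm is TRACELESS.
[cite: Balaban1987RG1, (0.9) p.253] -/
theorem trace_meanLog {W : ι → Matrix n n ℂ} (hW : ∀ i, W i ∈ Matrix.specialUnitaryGroup n ℂ)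
    (hs : ∀ i, ‖W i - 1‖ ≤ 1 / 3) (hπ : ∀ i, Fintype.card n * ‖W i - 1‖ < Real.pi) : (meanLog W).trace = 0 := by
  unfold meanLog
  rw [Matrix.trace_smul, Matrix.trace_sum, Finset.sum_eq_zero fun i _ => trace_mlog_eq_zero (hW i) (hs i) (hπ i), smul_zero]

/-- **`SU(N)`-valuedness of `exp(r · M)` for a skew-Hermitian traceless `M` and real `r`** (the exponent stays in `su(N)`).
[cite: Balaban1987RG1, (0.9) p.253] -/
theorem exp_smul_mem_specialUnitaryGroup {M : Matrix n n ℂ} (hM : star M = -M) (htr : M.trace = 0) (r : ℝ) :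
    exp ((r : ℂ) • M) ∈ Matrix.specialUnitaryGroup n ℂ := by
  letI : NormedAlgebra ℚ (Matrix n n ℂ) := NormedAlgebra.restrictScalars ℚ ℂ _
  have hrM : star ((r : ℂ) • M) = -((r : ℂ) • M) := by
    rw [star_smul, Complex.star_def, Complex.conj_ofReal, hM, smul_neg]
  rw [Matrix.mem_specialUnitaryGroup_iff]
  refine ⟨?_, ?_⟩
  · rw [Matrix.mem_unitaryGroup_iff, star_exp, hrM, ← exp_add_of_commute (Commute.refl _).neg_right, add_neg_cancel,
      exp_zero]
  · rw [det_exp_eq_exp_trace, Matrix.trace_smul, htr, smul_zero, exp_zero]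

/-- Hence: on an `SU(N)`-family inside the guard `‖W_i − 1‖ < δ_N`, `emlc r W ∈ SU(N)` for every real `r`.
[cite: Balaban1987RG1, (0.9) p.253] -/
theorem emlc_mem_specialUnitaryGroup [Nonempty n] (r : ℝ) {W : ι → Matrix n n ℂ}
    (hW : ∀ i, W i ∈ Matrix.specialUnitaryGroup n ℂ) (h : ∀ i, ‖W i - 1‖ < deltaSU n) :
    emlc r W ∈ Matrix.specialUnitaryGroup n ℂ :=
  exp_smul_mem_specialUnitaryGroup
    (star_meanLog (fun i => (Matrix.mem_specialUnitaryGroup_iff.1 (hW i)).1) fun i => (lt_third_of_lt_deltaSU (h i)).le)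
    (trace_meanLog hW (fun i => (lt_third_of_lt_deltaSU (h i)).le) fun i => mul_lt_pi_of_lt_deltaSU (h i)) r

end Matrices

/-! ## 3. The continuous inhabitant on `SU(N)`-families -/

section SUN

open scoped Matrix.Norms.L2Operator

variable {n : Type*} [Fintype n] [DecidableEq n] [Nonempty n] {ι : Type*} [Fintype ι]

/-- The CUTOFF `χ(W) = ∏_i φ_{δ_N}(‖W_i − 1‖) ∈ [0, 1]` of an `SU(N)`-family. [folklore] -/
def cutoff (W : ι → Matrix.specialUnitaryGroup n ℂ) : ℝ := ∏ i, cutProfile (deltaSU n) ‖(W i : Matrix n n ℂ) - 1‖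

/-- `χ(W) = 1` on the half-guard `∀ i, ‖W_i − 1‖ ≤ δ_N/2`. [folklore] -/
private theorem cutoff_eq_one {W : ι → Matrix.specialUnitaryGroup n ℂ} (h : ∀ i, ‖(W i : Matrix n n ℂ) - 1‖ ≤ deltaSU n / 2) :
    cutoff W = 1 :=
  Finset.prod_eq_one fun i _ => cutProfile_eq_one deltaSU_pos (h i)

/-- `χ(W) = 0` as soon as some `‖W_i − 1‖ ≥ 3δ_N/4`. [folklore] -/
private theorem cutoff_eq_zero {W : ι → Matrix.specialUnitaryGroup n ℂ} {i : ι} (h : 3 * deltaSU n / 4 ≤ ‖(W i : Matrix n n ℂ) - 1‖) :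
    cutoff W = 0 :=
  Finset.prod_eq_zero (Finset.mem_univ i) (cutProfile_eq_zero deltaSU_pos h)

/-- If `χ(W) ≠ 0` then the family is inside the guard `∀ i, ‖W_i − 1‖ < δ_N`. [folklore] -/
private theorem small_of_cutoff_ne_zero {W : ι → Matrix.specialUnitaryGroup n ℂ} (h : cutoff W ≠ 0) (i : ι) :
    ‖(W i : Matrix n n ℂ) - 1‖ < deltaSU n := by
  by_contra hle
  exact h (cutoff_eq_zero ((by linarith [deltaSU_pos (n := n)] : 3 * deltaSU n / 4 ≤ deltaSU n).trans (not_lt.mp hle)))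

omit [Nonempty n] in
/-- The cutoff is invariant under pointwise inversion (`‖W⁻¹ − 1‖ = ‖W* − 1‖ = ‖W − 1‖`). [folklore] -/
private theorem cutoff_inv (W : ι → Matrix.specialUnitaryGroup n ℂ) : cutoff (fun i => (W i)⁻¹) = cutoff W := by
  unfold cutoff
  refine Finset.prod_congr rfl fun i _ => ?_
  show cutProfile (deltaSU n) ‖star (W i : Matrix n n ℂ) - 1‖ = _
  rw [norm_star_sub_one]

omit [Nonempty n] in
/-- The cutoff is invariant under simultaneous conjugation. [folklore] -/
private theorem cutoff_conj (W : ι → Matrix.specialUnitaryGroup n ℂ) (u : Matrix.specialUnitaryGroup n ℂ) :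
    cutoff (fun i => u * W i * u⁻¹) = cutoff W := by
  have hu : (u : Matrix n n ℂ) ∈ Matrix.unitaryGroup n ℂ := (Matrix.mem_specialUnitaryGroup_iff.1 u.2).1
  have hu' : ((u⁻¹ : Matrix.specialUnitaryGroup n ℂ) : Matrix n n ℂ) ∈ Matrix.unitaryGroup n ℂ :=
    (Matrix.mem_specialUnitaryGroup_iff.1 (u⁻¹).2).1
  have hvw : (u : Matrix n n ℂ) * ((u⁻¹ : Matrix.specialUnitaryGroup n ℂ) : Matrix n n ℂ) = 1 :=
    Unitary.mul_star_self_of_mem hu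
  unfold cutoff
  refine Finset.prod_congr rfl fun i _ => ?_
  show cutProfile (deltaSU n)
      ‖(u : Matrix n n ℂ) * (W i : Matrix n n ℂ) * ((u⁻¹ : Matrix.specialUnitaryGroup n ℂ) : Matrix n n ℂ) - 1‖ = _
  rw [norm_conj_sub_one_eq hu hu' hvw]

omit [Nonempty n] in
/-- The cutoff is invariant under reindexing. [folklore] -/
private theorem cutoff_comp_equiv (W : ι → Matrix.specialUnitaryGroup n ℂ) (σ : Equiv.Perm ι) : cutoff (W ∘ σ) = cutoff W := by
  unfold cutoff
  exact Fintype.prod_equiv σ _ _ fun i => rfl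

/-- **THE CONTINUOUS TOTAL EXTENSION `E_c(W) = exp[χ(W) · |I|⁻¹ Σ_i log W_i]` of the printed operation on `SU(N)`-families**
(`SU(N)`-valued: where `χ ≠ 0` the family is inside the guard and §2 applies; where `χ = 0` the value is `1`).
[cite: Balaban1987RG1, (0.4)/(0.9) p.253] -/
def ESUc (W : ι → Matrix.specialUnitaryGroup n ℂ) : Matrix.specialUnitaryGroup n ℂ :=
  ⟨emlc (cutoff W) (fun i => (W i : Matrix n n ℂ)), by
    by_cases h : cutoff W = 0
    · rw [h, emlc_zero]; exact Submonoid.one_mem _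
    · exact emlc_mem_specialUnitaryGroup _ (fun i => (W i).2) (small_of_cutoff_ne_zero h)⟩

/-- Unfolding the coercion of `ESUc`. [cite: Balaban1987RG1, (0.4) p.253] -/
theorem coe_ESUc (W : ι → Matrix.specialUnitaryGroup n ℂ) :
    ((ESUc W : Matrix.specialUnitaryGroup n ℂ) : Matrix n n ℂ) = emlc (cutoff W) (fun i => (W i : Matrix n n ℂ)) := rfl

/-- **On the half-guard `E_c` IS the printed operation**: `E_c(W) = exp[i Σ |I|⁻¹ (1/i) log W_i]` whenever all
`‖W_i − 1‖ ≤ δ_N/2`. [cite: Balaban1987RG1, (0.4) p.253] -/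
theorem coe_ESUc_of_small {W : ι → Matrix.specialUnitaryGroup n ℂ} (h : ∀ i, ‖(W i : Matrix n n ℂ) - 1‖ ≤ deltaSU n / 2) :
    ((ESUc W : Matrix.specialUnitaryGroup n ℂ) : Matrix n n ℂ) = eml fun i => (W i : Matrix n n ℂ) := by
  rw [coe_ESUc, cutoff_eq_one h, emlc_one]

/-- On the half-guard `E_c` agrees with the sibling module's guarded extension `ESU`. [cite: Balaban1987RG1, (0.4) p.253] -/
theorem ESUc_eq_ESU_of_small {W : ι → Matrix.specialUnitaryGroup n ℂ}
    (h : ∀ i, ‖(W i : Matrix n n ℂ) - 1‖ ≤ deltaSU n / 2) : ESUc W = ESU W := by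
  apply Subtype.ext
  rw [coe_ESUc_of_small h, coe_ESU_of_small fun i => (h i).trans_lt (by linarith [deltaSU_pos (n := n)])]

/-- **`E_c(W) = 1` as soon as some `‖W_i − 1‖ ≥ 3δ_N/4`** — in particular off the guard. [cite: Balaban1987RG1, (0.4) p.253] -/
theorem ESUc_eq_one_of_le {W : ι → Matrix.specialUnitaryGroup n ℂ} {i : ι}
    (h : 3 * deltaSU n / 4 ≤ ‖(W i : Matrix n n ℂ) - 1‖) : ESUc W = 1 :=
  Subtype.ext (by rw [coe_ESUc, cutoff_eq_zero h, emlc_zero]; rfl)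

/-- `E_c(W) = 1` off the guard `∀ i, ‖W_i − 1‖ < δ_N`. [cite: Balaban1987RG1, (0.4) p.253] -/
theorem ESUc_of_not_small {W : ι → Matrix.specialUnitaryGroup n ℂ} (h : ¬ ∀ i, ‖(W i : Matrix n n ℂ) - 1‖ < deltaSU n) :
    ESUc W = 1 := by
  obtain ⟨i, hi⟩ := not_forall.mp h
  exact ESUc_eq_one_of_le ((by linarith [deltaSU_pos (n := n)] : 3 * deltaSU n / 4 ≤ deltaSU n).trans (not_lt.mp hi))

/-- **(0.7) for `E_c`** (all families). [cite: Balaban1987RG1, (0.7) p.253] -/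
theorem ESUc_perm (W : ι → Matrix.specialUnitaryGroup n ℂ) (σ : Equiv.Perm ι) : ESUc (W ∘ σ) = ESUc W := by
  apply Subtype.ext
  rw [coe_ESUc, coe_ESUc, cutoff_comp_equiv]
  exact emlc_comp_equiv _ (fun i => (W i : Matrix n n ℂ)) σ

/-- **(0.5) for `E_c`** on the guard (the scaled exponents of `W` and `W⁻¹` are opposite, with the SAME scale `χ(W⁻¹) = χ(W)`).
[cite: Balaban1987RG1, (0.5) p.253] -/
theorem ESUc_inv {W : ι → Matrix.specialUnitaryGroup n ℂ} (h : ∀ i, ‖(W i : Matrix n n ℂ) - 1‖ < deltaSU n) :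
    ESUc (fun i => (W i)⁻¹) = (ESUc W)⁻¹ := by
  apply eq_inv_of_mul_eq_one_left
  apply Subtype.ext
  show ((ESUc fun i => (W i)⁻¹) : Matrix n n ℂ) * (ESUc W : Matrix n n ℂ) = 1
  rw [coe_ESUc, coe_ESUc, cutoff_inv]
  exact emlc_inv_mul _ (fun i => Unitary.mul_star_self_of_mem (Matrix.mem_specialUnitaryGroup_iff.1 (W i).2).1)
    fun i => (lt_third_of_lt_deltaSU (h i)).le

/-- **(0.6) for `E_c`, conjugations** (in fact for ALL families; stated on the guard as the structure asks).
[cite: Balaban1987RG1, (0.6) p.253] -/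
theorem ESUc_conj (W : ι → Matrix.specialUnitaryGroup n ℂ) (u : Matrix.specialUnitaryGroup n ℂ) :
    ESUc (fun i => u * W i * u⁻¹) = u * ESUc W * u⁻¹ := by
  have hu : (u : Matrix n n ℂ) ∈ Matrix.unitaryGroup n ℂ := (Matrix.mem_specialUnitaryGroup_iff.1 u.2).1
  have hvw : (u : Matrix n n ℂ) * ((u⁻¹ : Matrix.specialUnitaryGroup n ℂ) : Matrix n n ℂ) = 1 :=
    Unitary.mul_star_self_of_mem hu
  have hwv : ((u⁻¹ : Matrix.specialUnitaryGroup n ℂ) : Matrix n n ℂ) * (u : Matrix n n ℂ) = 1 :=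
    Unitary.star_mul_self_of_mem hu
  apply Subtype.ext
  show ((ESUc fun i => u * W i * u⁻¹) : Matrix n n ℂ) =
    (u : Matrix n n ℂ) * (ESUc W : Matrix n n ℂ) * ((u⁻¹ : Matrix.specialUnitaryGroup n ℂ) : Matrix n n ℂ)
  rw [coe_ESUc, coe_ESUc, cutoff_conj]
  exact emlc_conj _ hvw hwv fun i => (W i : Matrix n n ℂ)

/-- **THE CONTINUOUS PRINTED SMALL-LOOP AVERAGE ON `SU(N)`** as an inhabitant of `LoopAverage SU(N)`: radius
`δ_N = min(1/3, π/N)` (the same as `expMeanLogSU`), `E = E_c`; the axioms (0.5), (0.6), (0.7) PROVED on the guard.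
In the model `dist1 W = ‖W − 1‖` (`UnitaryModel`, `rfl`). [cite: Balaban1987RG1, (0.4)–(0.7) p.253] -/
def expMeanLogSUc : LoopAverage (Matrix.specialUnitaryGroup n ℂ) where
  δ := deltaSU n
  δ_pos := deltaSU_pos
  E := fun W => ESUc W
  inv := fun _ hW => ESUc_inv hW
  conj := fun W _ u => ESUc_conj W u
  perm := fun W _ σ => ESUc_perm W σ

/-- The radius of `expMeanLogSUc` is that of `expMeanLogSU`. [cite: Balaban1987RG1, (0.4) p.253] -/
theorem expMeanLogSUc_δ : (expMeanLogSUc (n := n)).δ = (expMeanLogSU (n := n)).δ := rfl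

/-- On the half-guard the two inhabitants AGREE (both are the printed operation). [cite: Balaban1987RG1, (0.4) p.253] -/
theorem expMeanLogSUc_E_eq {m : ℕ} (W : Fin (m + 1) → Matrix.specialUnitaryGroup n ℂ)
    (hW : ∀ i, dist1 (W i) ≤ deltaSU n / 2) :
    (expMeanLogSUc (n := n)).E W = (expMeanLogSU (n := n)).E W :=
  ESUc_eq_ESU_of_small hW

/-! ### Continuity -/

omit [Nonempty n] in
/-- The cutoff is continuous. [folklore] -/
private theorem continuous_cutoff : Continuous (cutoff : (ι → Matrix.specialUnitaryGroup n ℂ) → ℝ) := by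
  unfold cutoff
  refine continuous_finsetProd _ fun i _ => (continuous_cutProfile _).comp ?_
  exact ((continuous_subtype_val.comp (continuous_apply i)).sub continuous_const).norm

omit [Nonempty n] in
/-- The mean logarithm is continuous at every family of matrices with all `‖W_i − 1‖ < 1` (the series logarithm is analytic
there). [folklore] -/
private theorem continuousAt_meanLog {W : ι → Matrix n n ℂ} (hW : ∀ i, ‖W i - 1‖ < 1) :
    ContinuousAt (meanLog : (ι → Matrix n n ℂ) → Matrix n n ℂ) W := by
  have hsum : ContinuousAt (fun W : ι → Matrix n n ℂ => ∑ i, mlog (W i)) W :=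
    tendsto_finsetSum _ fun i _ =>
      ContinuousAt.comp (f := fun W : ι → Matrix n n ℂ => W i) (AnalyticAt.continuousAt (analyticAt_mlog (hW i)))
        (continuous_apply (A := fun _ : ι => Matrix n n ℂ) i).continuousAt
  unfold meanLog
  exact (continuousAt_const (y := ((Fintype.card ι : ℂ))⁻¹)).smul hsum

/-- **`E_c` is CONTINUOUS** as a matrix-valued map of the family. [cite: Balaban1987RG1, (0.4) p.253] -/
theorem continuous_coe_ESUc :
    Continuous fun W : ι → Matrix.specialUnitaryGroup n ℂ => ((ESUc W : Matrix.specialUnitaryGroup n ℂ) : Matrix n n ℂ) := by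
  letI : NormedAlgebra ℚ (Matrix n n ℂ) := NormedAlgebra.restrictScalars ℚ ℂ _
  have hcoe : Continuous fun W : ι → Matrix.specialUnitaryGroup n ℂ => fun i => (W i : Matrix n n ℂ) :=
    continuous_pi fun i => continuous_subtype_val.comp (continuous_apply i)
  simp only [coe_ESUc, emlc]
  refine exp_continuous.comp (continuous_iff_continuousAt.2 fun W => ?_)
  by_cases h : ∀ i, ‖(W i : Matrix n n ℂ) - 1‖ < 1
  · -- inside the unit guard: both factors are continuous at `W`
    have h2 : ContinuousAt (fun W' : ι → Matrix.specialUnitaryGroup n ℂ => meanLog fun i => (W' i : Matrix n n ℂ)) W :=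
      ContinuousAt.comp (f := fun W' : ι → Matrix.specialUnitaryGroup n ℂ => fun i => (W' i : Matrix n n ℂ))
        (continuousAt_meanLog h) hcoe.continuousAt
    exact ((Complex.continuous_ofReal.comp continuous_cutoff).continuousAt).smul h2
  · -- some `‖W_i − 1‖ ≥ 1 > 3δ_N/4`: the cutoff vanishes on a neighbourhood of `W`
    obtain ⟨i, hi⟩ := not_forall.mp h
    have hi : 1 ≤ ‖(W i : Matrix n n ℂ) - 1‖ := not_lt.mp hi
    have hδ : 3 * deltaSU n / 4 < 1 := by
      have := lt_third_of_lt_deltaSU (n := n) (t := deltaSU n / 2) (by linarith [deltaSU_pos (n := n)])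
      linarith
    have hopen : IsOpen {W' : ι → Matrix.specialUnitaryGroup n ℂ | 3 * deltaSU n / 4 < ‖(W' i : Matrix n n ℂ) - 1‖} :=
      isOpen_lt continuous_const ((continuous_subtype_val.comp (continuous_apply i)).sub continuous_const).norm
    have hmem : W ∈ {W' : ι → Matrix.specialUnitaryGroup n ℂ | 3 * deltaSU n / 4 < ‖(W' i : Matrix n n ℂ) - 1‖} :=
      hδ.trans_le hi
    have hev : (fun W' : ι → Matrix.specialUnitaryGroup n ℂ =>
        ((cutoff W' : ℂ)) • meanLog fun i => (W' i : Matrix n n ℂ)) =ᶠ[𝓝 W] fun _ => 0 :=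
      Filter.eventually_of_mem (hopen.mem_nhds hmem) fun W' hW' => by
        simp only [Set.mem_setOf_eq] at hW'
        show ((cutoff W' : ℂ)) • meanLog (fun i => (W' i : Matrix n n ℂ)) = 0
        rw [cutoff_eq_zero hW'.le, Complex.ofReal_zero, zero_smul]
    exact (continuousAt_congr hev).2 continuousAt_const

/-- **`E_c` is CONTINUOUS** `: (I → SU(N)) → SU(N)`. [cite: Balaban1987RG1, (0.4) p.253] -/
theorem continuous_ESUc : Continuous (ESUc : (ι → Matrix.specialUnitaryGroup n ℂ) → Matrix.specialUnitaryGroup n ℂ) :=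
  Topology.IsInducing.subtypeVal.continuous_iff.2 continuous_coe_ESUc

/-- `E_c` is measurable (Borel; it is continuous). [cite: Balaban1987RG1, (0.4) p.253] -/
theorem measurable_ESUc : Measurable (ESUc : (ι → Matrix.specialUnitaryGroup n ℂ) → Matrix.specialUnitaryGroup n ℂ) := by
  haveI : SecondCountableTopology (Matrix n n ℂ) := inferInstanceAs (SecondCountableTopology (n → n → ℂ))
  haveI : SecondCountableTopology (Matrix.specialUnitaryGroup n ℂ) :=
    Topology.IsEmbedding.subtypeVal.secondCountableTopology
  exact continuous_ESUc.measurable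

/-- The `E` of `expMeanLogSUc` is continuous in every arity. [cite: Balaban1987RG1, (0.4) p.253] -/
theorem continuous_expMeanLogSUc_E (m : ℕ) :
    Continuous fun W : Fin (m + 1) → Matrix.specialUnitaryGroup n ℂ => (expMeanLogSUc (n := n)).E W :=
  continuous_ESUc

/-- The `E` of `expMeanLogSUc` is measurable in every arity (so every measurability consequence proved for `expMeanLogSU`
in the tree is available for `expMeanLogSUc` through `BlockAveraging.measurable_avgFun`). [cite: Balaban1987RG1, (0.4) p.253] -/
theorem measurable_expMeanLogSUc_E (m : ℕ) :
    Measurable fun W : Fin (m + 1) → Matrix.specialUnitaryGroup n ℂ => (expMeanLogSUc (n := n)).E W :=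
  measurable_ESUc

/-- The `E` of `expMeanLogSUc` is `1` off its guard (no jump in the guarded correction factor of (0.4)). [cite: Balaban1987RG1, (0.4) p.253] -/
theorem expMeanLogSUc_E_of_not_small {m : ℕ} {W : Fin (m + 1) → Matrix.specialUnitaryGroup n ℂ}
    (h : ¬ ∀ i, dist1 (W i) < (expMeanLogSUc (n := n)).δ) : (expMeanLogSUc (n := n)).E W = 1 :=
  ESUc_of_not_small h

end SUN

end ExpMeanLog

/-! ## 4. Consequence: the total block averaging (0.4) with `expMeanLogSUc` is CONTINUOUS -/

/-- The product topology on configurations `GaugeField P j G = (PBond P j → G)` (the σ-algebra instance of `Setup` is the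
product σ-algebra in the same way). [folklore] -/
instance instTopologicalSpaceGaugeField {P : Params} {j : ℕ} {G : Type*} [TopologicalSpace G] :
    TopologicalSpace (GaugeField P j G) :=
  inferInstanceAs (TopologicalSpace (PBond P j → G))

namespace BlockAveraging

open ExpMeanLog T4Continuum AveragingRT
open scoped Matrix.Norms.L2Operator

variable {P : Params} {j : ℕ} {n : Type*} [Fintype n] [DecidableEq n] [Nonempty n]


/-- With `expMeanLogSUc` the guarded correction factor of (0.4) has NO JUMP: `corr U c = E_c(loop variables)` for every
configuration (off the small-field domain both sides are `1`). [cite: Balaban1987RG1, (0.4) p.253] -/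
theorem corr_expMeanLogSUc_eq (U : GaugeField P j (Matrix.specialUnitaryGroup n ℂ)) (c : PBond P (j+1)) :
    corr (expMeanLogSUc (n := n)) U c = (expMeanLogSUc (n := n)).avg (loopHol U c) := by
  unfold corr
  split_ifs with h
  · rfl
  · symm
    unfold LoopAverage.avg
    exact expMeanLogSUc_E_of_not_small fun h' => h fun i => by
      have := h' (LoopAverage.enum (Idx P) i)
      simpa using this

/-- Holonomies along a fixed list of steps are continuous in the configuration (finite products and inverses in the
topological group `SU(N)`). [cite: ChatterjeeYMProb2019, §2] -/
theorem continuous_holAt (γ : List (LStep P j)) : Continuous fun U : GaugeField P j (Matrix.specialUnitaryGroup n ℂ) => T4Continuum.holAt U γ := by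
  induction γ with
  | nil => simp only [T4Continuum.holAt, List.map_nil, List.prod_nil]; exact continuous_const
  | cons s γ ih =>
    have hs : Continuous fun U : GaugeField P j (Matrix.specialUnitaryGroup n ℂ) => if s.fwd then U s.bond else (U s.bond)⁻¹ := by
      obtain ⟨b, f⟩ := s
      cases f
      · simp only [Bool.false_eq_true, ↓reduceIte]
        exact (continuous_apply b).inv
      · simp only [↓reduceIte]
        exact continuous_apply b
    have h : (fun U : GaugeField P j (Matrix.specialUnitaryGroup n ℂ) => T4Continuum.holAt U (s :: γ)) =
        fun U => (if s.fwd then U s.bond else (U s.bond)⁻¹) * T4Continuum.holAt U γ := by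
      funext U
      simp only [T4Continuum.holAt, List.map_cons, List.prod_cons]
    rw [h]
    exact hs.mul ih

/-- The loop variables of (0.4) are continuous in the configuration. [cite: Balaban1987RG1, (0.4) p.253] -/
theorem continuous_loopHol (c : PBond P (j+1)) : Continuous fun U : GaugeField P j (Matrix.specialUnitaryGroup n ℂ) => loopHol U c :=
  continuous_pi fun _ => continuous_holAt _

/-- The axial (straight-line) average is continuous in the configuration. [cite: Balaban1984PropagatorsI, (1.7) p.18] -/
theorem continuous_axialAvg : Continuous (axialAvg : GaugeField P j (Matrix.specialUnitaryGroup n ℂ) → GaugeField P (j+1) (Matrix.specialUnitaryGroup n ℂ)) := by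
  refine continuous_pi fun c => ?_
  show Continuous fun U : GaugeField P j (Matrix.specialUnitaryGroup n ℂ) => pathProd U c P.L
  suffices h : ∀ m : ℕ, Continuous fun U : GaugeField P j (Matrix.specialUnitaryGroup n ℂ) => pathProd U c m from h P.L
  intro m
  induction m with
  | zero => simp only [pathProd]; exact continuous_const
  | succ m ih =>
    simp only [pathProd]
    exact ih.mul (continuous_apply _)

/-- **THE TOTAL BLOCK AVERAGING (0.4) WITH THE CONTINUOUS SMALL-LOOP AVERAGE IS CONTINUOUS** in the configuration, at
every level `j` of every lattice `P`. [cite: Balaban1987RG1, (0.4) p.253] -/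
theorem continuous_avgFun_expMeanLogSUc :
    Continuous (avgFun (expMeanLogSUc (n := n)) : GaugeField P j (Matrix.specialUnitaryGroup n ℂ) → GaugeField P (j+1) (Matrix.specialUnitaryGroup n ℂ)) := by
  refine continuous_pi fun c => ?_
  have hcorr : Continuous fun U : GaugeField P j (Matrix.specialUnitaryGroup n ℂ) => corr (expMeanLogSUc (n := n)) U c := by
    simp only [corr_expMeanLogSUc_eq]
    unfold LoopAverage.avg
    exact continuous_ESUc.comp
      ((continuous_pi fun k => (continuous_apply _).comp (continuous_loopHol c)))
  show Continuous fun U : GaugeField P j (Matrix.specialUnitaryGroup n ℂ) => corr (expMeanLogSUc (n := n)) U c * axialAvg U c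
  exact hcorr.mul ((continuous_apply c).comp continuous_axialAvg)

/-- Iterated block averaging with `expMeanLogSUc` (from the finest level to level `k`) is continuous. [cite: Balaban1987RG1, (0.11) p.253] -/
theorem continuous_iter_blockAvg_expMeanLogSUc :
    ∀ k : ℕ, Continuous (Averaging.iter (fun j => blockAvg (P := P) (j := j) (expMeanLogSUc (n := n))) k)
  | 0 => continuous_id
  | k + 1 => (continuous_avgFun_expMeanLogSUc (j := k)).comp (continuous_iter_blockAvg_expMeanLogSUc k)

/-- The loop variable `Re tr 𝒰(γ)` of the once-block-averaged field is a CONTINUOUS function of the finer field — the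
property the uniform density arguments (Lévy / Stone–Weierstrass, tree `WilsonLoopDensityFiniteGraph`) need and which
fails for the discontinuous extension `expMeanLogSU`. [cite: Balaban1987RG1, (0.2)/(0.4) p.252] -/
theorem continuous_loopAt_avgFun_expMeanLogSUc (γ : List (LStep P (j+1))) :
    Continuous fun U : GaugeField P j (Matrix.specialUnitaryGroup n ℂ) => T4Continuum.loopAt (avgFun (expMeanLogSUc (n := n)) U) γ := by
  unfold T4Continuum.loopAt
  have hre : Continuous (reTr : Matrix.specialUnitaryGroup n ℂ → ℝ) :=
    UnitaryModel.continuous_nReTr.comp (Literature.MathematicalPhysics.QuantumLattice.continuous_fundamentalRep n)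
  exact hre.comp ((continuous_holAt γ).comp continuous_avgFun_expMeanLogSUc)

end BlockAveraging

end Literature.MathematicalPhysics.QuantumFieldTheory.Balaban1983to89
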